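import Mathlib
import Literature.Probability.LatticeModels.ChessboardEstimateAssignments
import HarnessLib

/-!
# The chessboard estimate for observables from reflection positivity on an even block torus
# (Fröhlich–Israel–Lieb–Simon 1978, Thm 4.1 / 4.3 — observable form)

Topic `Literature/Probability/LatticeModels` (kind proof; no new notions).  The tree's
`chessboard_abs_pow_le_prod_const` (`ChessboardEstimateAssignments.lean`) is the COMBINATORIAL chessboard
estimate: a real functional `ψ` of label assignments `σ : (ℤ/N)^d → ι` (`N` even, `d ≥ 1`) satisfying
reflection positivity and reflection Cauchy–Schwarz for the two symmetrisations `asgSymP i k σ`,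
`asgSymM i k σ` through every block boundary obeys `|ψ σ| ^ (N^d) ≤ ∏_c ψ (const (σ c))`.  This file derives
from it the MEASURE-THEORETIC (observable) form that applications consume (FILS 1978 Thm 4.1 with the
reflection-positivity input of Thm 4.3; Friedli–Velenik 2017 Thm 10.11; Biskup 2009 Thm 5.8):

Let `μ` be a probability measure on a configuration space `Ω`; for every direction `i : Fin d` and block
boundary `k : ℤ/N` let `Θ i k : Ω → Ω` be a `μ`-preserving involution (the reflection through the
boundaries `k`, `k + N/2`) and `𝓕₊ i k` a sub-σ-algebra (observables of the positive half `halfPlus N i k`)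
such that `μ` is REFLECTION POSITIVE: `0 ≤ ∫ F · (F ∘ Θ i k) dμ` for every bounded `𝓕₊ i k`-measurable `F`.
Let `g a c : Ω → ℝ` (`a : ι` a label, `c` a block) be bounded measurable observables forming a COHERENT
REFLECTED ARRAY — `g a (θ_{ik} c) = g a c ∘ Θ i k` for the block reflection `θ_{ik} = cellReflect i k` — and
localised: `g a c` is `𝓕₊ i k`-measurable whenever `c ∈ halfPlus N i k`.  Then for every assignment `σ`

  `|∫ ∏_c g (σ c) c dμ| ^ (N^d) ≤ ∏_c ∫ ∏_{c'} g (σ c) c' dμ`      (`chessboard_integral_prod_of_reflectionPositive`),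

i.e. `|⟨∏_c f_c⟩| ≤ ∏_c γ(f_c)` with `γ(f) = ⟨full reflected array of f⟩ ^ (1/N^d)` (FILS (4.3) / Friedli–Velenik
(10.20); root form `chessboard_integral_prod_le_prod_rpow`), and the same for a product over a SUBSET of
blocks, the other blocks carrying `1` (`chessboard_integral_prod_subset_le`).  The two ingredients are the
reflection Cauchy–Schwarz inequality `(∫ P·(Q∘Θ))² ≤ (∫ P·(P∘Θ)) (∫ Q·(Q∘Θ))` for `𝓕₊`-measurable `P, Q`
(`rp_cauchySchwarz_of_reflectionPositive`: positivity of the quadratic form `t ↦ ⟨(P+tQ)·((P+tQ)∘Θ)⟩` and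
its symmetry, `Θ` being a measure-preserving involution) and the identification of the three assignment
weights `ψ (asgSymP σ) = ⟨P·(P∘Θ)⟩`, `ψ (asgSymM σ) = ⟨Q·(Q∘Θ)⟩`, `ψ σ = ⟨P·(Q∘Θ)⟩` with
`P = ∏_{c ∈ H₊} g (σ c) c`, `Q = ∏_{c ∈ H₊} g (σ (θc)) c` (coherence + `θ H₊ = H₋`).

Wanted by route `QuantumFields/DyadicChessboard` (support `ChessboardTransfer`, stmt-QuantumFields-23370;
fact request wi-90608 «abstract chessboard estimate from reflection positivity on even discrete tori»): the
instance there is the Wilson lattice gauge measure on the dyadic torus `(ℤ/2^m)^4` with cells of side `2^e`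
(tree reflection positivity `wilsonExpectation_reflectionPositive`).  No lattice gauge theory here.

## Mathlib

We USE `MeasureTheory.MeasurePreserving`, `MeasureTheory.integral_map`, `Finset.measurable_prod`,
`discrim_le_zero`-free elementary quadratic-form algebra, `Real.finset_prod_rpow`.  Mathlib (pinned) has no
reflection positivity / chessboard estimate (searched `chessboard`, `reflection positiv`).

## References

* J. Fröhlich, R. Israel, E. H. Lieb, B. Simon, *Phase transitions and reflection positivity. I. General
  theory and long range lattice models*, Comm. Math. Phys. 62 (1978) 1–34, Thm 4.1 (chessboard estimate,
  abstract form), Lemma 4.2 / Thm 4.3 (reflections in all lattice hyperplanes of an even torus); reprinted in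
  E. H. Lieb, *Statistical Mechanics — Selecta* [corpus:book:liebnd-statistical-mechanics p.206–208]
  [FrohlichIsraelLiebSimon1978].
* S. Friedli, Y. Velenik, *Statistical Mechanics of Lattice Systems*, CUP 2017, §10.3–10.4, Thm 10.11
  [corpus:book:friedli2017 p.483–489] [FriedliVelenik2017].
* M. Biskup, *Reflection positivity and phase transitions in lattice spin models*, LNM 1970 (2009), §5,
  Thm 5.8 (arXiv:math-ph/0610025) [Biskup2009].
-/

noncomputable section

namespace Literature.Probability.LatticeModels

open MeasureTheory Finset
open Literature.Barriers.CriticalPhenomena.NonGibbs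

variable {Ω : Type*} {m mΩ : MeasurableSpace Ω}

/-! ### Bounded measurable observables (bookkeeping) -/

/-- A measurable real function bounded in absolute value is integrable for a finite measure. [folklore] -/
private theorem cbObs_integrable_of_abs_le {μ : Measure Ω} [IsFiniteMeasure μ] {F : Ω → ℝ}
    (hF : Measurable F) {C : ℝ} (hC : ∀ ω, |F ω| ≤ C) : Integrable F μ :=
  (integrable_const C).mono' hF.aestronglyMeasurable
    (Filter.Eventually.of_forall fun ω => by rw [Real.norm_eq_abs]; exact hC ω)

/-- A finite product of functions bounded in absolute value is bounded in absolute value. [folklore] -/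
private theorem cbObs_exists_abs_prod_le {α : Type*} (s : Finset α) {f : α → Ω → ℝ}
    (hf : ∀ a ∈ s, ∃ C, ∀ ω, |f a ω| ≤ C) : ∃ C, ∀ ω, |∏ a ∈ s, f a ω| ≤ C := by
  classical
  choose! C hC using hf
  refine ⟨∏ a ∈ s, C a, fun ω => ?_⟩
  rw [Finset.abs_prod]
  exact Finset.prod_le_prod (fun a _ => abs_nonneg _) fun a ha => hC a ha ω

/-! ### Reflection positivity ⇒ reflection Cauchy–Schwarz -/

section RPCS

variable {μ : Measure Ω} [IsProbabilityMeasure μ] {Θ : Ω → Ω}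

omit [IsProbabilityMeasure μ] in
/-- For a measure-preserving involution `Θ`: `∫ F · (G ∘ Θ) = ∫ G · (F ∘ Θ)` (substitute `ω ↦ Θ ω`). [folklore] -/
private theorem cbObs_integral_mul_comp_comm (hΘ : MeasurePreserving Θ μ μ) (hΘΘ : ∀ ω, Θ (Θ ω) = ω)
    {F G : Ω → ℝ} (hF : Measurable F) (hG : Measurable G) :
    ∫ ω, F ω * G (Θ ω) ∂μ = ∫ ω, G ω * F (Θ ω) ∂μ := by
  have hint : ∫ ω, G ω * F (Θ ω) ∂μ = ∫ ω, (fun ω' => G ω' * F (Θ ω')) (Θ ω) ∂μ := by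
    have hae : AEStronglyMeasurable (fun ω' => G ω' * F (Θ ω')) (μ.map Θ) := by
      rw [hΘ.map_eq]; exact (hG.mul (hF.comp hΘ.measurable)).aestronglyMeasurable
    rw [← integral_map hΘ.measurable.aemeasurable hae, hΘ.map_eq]
  rw [hint]
  refine integral_congr_ae (Filter.Eventually.of_forall fun ω => ?_)
  simp only [hΘΘ, mul_comm]

/-- **Reflection Cauchy–Schwarz from reflection positivity** (FILS 1978 §2 / Thm 2.1; Friedli–Velenik
Lemma 10.6): if `Θ` is a `μ`-preserving involution and `0 ≤ ∫ F · (F ∘ Θ) dμ` for every bounded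
`m`-measurable `F`, then `(∫ P · (Q ∘ Θ))² ≤ (∫ P · (P ∘ Θ)) · (∫ Q · (Q ∘ Θ))` for bounded `m`-measurable
`P, Q` — positivity of the quadratic form `t ↦ ⟨(P + tQ)·((P + tQ) ∘ Θ)⟩`, whose mixed coefficient is
symmetric by `cbObs_integral_mul_comp_comm`. [cite: FrohlichIsraelLiebSimon1978, Thm 2.1] -/
theorem rp_cauchySchwarz_of_reflectionPositive (hm : m ≤ mΩ) (hΘ : MeasurePreserving Θ μ μ)
    (hΘΘ : ∀ ω, Θ (Θ ω) = ω)
    (hRP : ∀ F : Ω → ℝ, Measurable[m] F → (∃ C, ∀ ω, |F ω| ≤ C) → 0 ≤ ∫ ω, F ω * F (Θ ω) ∂μ)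
    {P Q : Ω → ℝ} (hP : Measurable[m] P) (hQ : Measurable[m] Q) (hPb : ∃ C, ∀ ω, |P ω| ≤ C)
    (hQb : ∃ C, ∀ ω, |Q ω| ≤ C) :
    (∫ ω, P ω * Q (Θ ω) ∂μ) ^ 2 ≤ (∫ ω, P ω * P (Θ ω) ∂μ) * ∫ ω, Q ω * Q (Θ ω) ∂μ := by
  have hP' : Measurable P := hP.mono hm le_rfl
  have hQ' : Measurable Q := hQ.mono hm le_rfl
  have hΘm : Measurable Θ := hΘ.measurable
  obtain ⟨CP, hCP⟩ := hPb
  obtain ⟨CQ, hCQ⟩ := hQb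
  -- integrability of the four products
  have hint : ∀ {F G : Ω → ℝ} (C₁ C₂ : ℝ), Measurable F → Measurable G → (∀ ω, |F ω| ≤ C₁) →
      (∀ ω, |G ω| ≤ C₂) → Integrable (fun ω => F ω * G (Θ ω)) μ := by
    intro F G C₁ C₂ hF hG hC₁ hC₂
    refine cbObs_integrable_of_abs_le (hF.mul (hG.comp hΘm)) (C := C₁ * C₂) fun ω => ?_
    rw [abs_mul]
    exact mul_le_mul (hC₁ ω) (hC₂ _) (abs_nonneg _) ((abs_nonneg _).trans (hC₁ ω))
  have iPP := hint CP CP hP' hP' hCP hCP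
  have iPQ := hint CP CQ hP' hQ' hCP hCQ
  have iQP := hint CQ CP hQ' hP' hCQ hCP
  have iQQ := hint CQ CQ hQ' hQ' hCQ hCQ
  set a : ℝ := ∫ ω, P ω * P (Θ ω) ∂μ with ha
  set b : ℝ := ∫ ω, P ω * Q (Θ ω) ∂μ with hb
  set c : ℝ := ∫ ω, Q ω * Q (Θ ω) ∂μ with hc
  have hsymm : ∫ ω, Q ω * P (Θ ω) ∂μ = b := (cbObs_integral_mul_comp_comm hΘ hΘΘ hP' hQ').symm
  -- the quadratic form `t ↦ ⟨(P + tQ)((P + tQ)∘Θ)⟩ = a + 2bt + ct²` is non-negative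
  have hquad : ∀ t : ℝ, 0 ≤ c * (t * t) + 2 * b * t + a := by
    intro t
    have hFm : Measurable[m] (fun ω => P ω + t * Q ω) := hP.add (hQ.const_mul t)
    have hFb : ∃ C, ∀ ω, |P ω + t * Q ω| ≤ C := ⟨CP + |t| * CQ, fun ω => by
      calc |P ω + t * Q ω| ≤ |P ω| + |t * Q ω| := abs_add_le _ _
        _ = |P ω| + |t| * |Q ω| := by rw [abs_mul]
        _ ≤ CP + |t| * CQ := add_le_add (hCP ω) (mul_le_mul_of_nonneg_left (hCQ ω) (abs_nonneg t))⟩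
    have h0 := hRP _ hFm hFb
    have hexp : (fun ω => (P ω + t * Q ω) * (P (Θ ω) + t * Q (Θ ω)))
        = fun ω => (P ω * P (Θ ω) + t * (P ω * Q (Θ ω))) + (t * (Q ω * P (Θ ω)) + t * t * (Q ω * Q (Θ ω))) := by
      funext ω; ring
    have i1 : Integrable (fun ω => t * (P ω * Q (Θ ω))) μ := iPQ.const_mul t
    have i2 : Integrable (fun ω => t * (Q ω * P (Θ ω))) μ := iQP.const_mul t
    have i3 : Integrable (fun ω => t * t * (Q ω * Q (Θ ω))) μ := iQQ.const_mul (t * t)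
    have i12 : Integrable (fun ω => P ω * P (Θ ω) + t * (P ω * Q (Θ ω))) μ := iPP.add i1
    have i34 : Integrable (fun ω => t * (Q ω * P (Θ ω)) + t * t * (Q ω * Q (Θ ω))) μ := i2.add i3
    rw [hexp, integral_add i12 i34, integral_add iPP i1, integral_add i2 i3,
      integral_const_mul, integral_const_mul, integral_const_mul, hsymm] at h0
    rw [← ha, ← hb, ← hc] at h0
    linarith
  -- discriminant
  have hdisc : discrim c (2 * b) a ≤ 0 := discrim_le_zero hquad
  rw [discrim] at hdisc
  nlinarith [hdisc]

end RPCS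

/-! ### Coherent reflected arrays: the three assignment weights -/

section Array

variable {d N : ℕ} [NeZero N] {ι : Type*}

/-- For even `N` the negative half is the image of the positive half under the block reflection.
[cite: FriedliVelenik2017, §10.3] -/
theorem halfMinus_eq_map_halfPlus (hN : Even N) (i : Fin d) (k : ZMod N) :
    halfMinus N i k = (halfPlus N i k).map (cellReflect i k).toEmbedding := by
  ext c
  rw [Finset.mem_map_equiv]
  constructor
  · intro hc
    have h := cellReflect_mem_halfPlus hN hc
    rwa [show (cellReflect i k).symm c = cellReflect i k c from rfl]
  · intro hc
    have h := cellReflect_mem_halfMinus hN hc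
    rwa [show (cellReflect i k).symm c = cellReflect i k c from rfl, cellReflect_cellReflect] at h

/-- The product over all blocks splits into the products over the two halves. [cite: FriedliVelenik2017, §10.3] -/
theorem prod_univ_eq_prod_halfPlus_mul_prod_halfMinus {M : Type*} [CommMonoid M] (i : Fin d) (k : ZMod N)
    (f : BlockIdx d N → M) :
    ∏ c, f c = (∏ c ∈ halfPlus N i k, f c) * ∏ c ∈ halfMinus N i k, f c := by
  rw [← Finset.prod_union (disjoint_halfPlus_halfMinus i k)]
  refine (Finset.prod_subset (Finset.subset_univ _) fun c _ hc => ?_).symm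
  exfalso
  rcases mem_halfPlus_or_mem_halfMinus i k c with h | h
  · exact hc (Finset.mem_union_left _ h)
  · exact hc (Finset.mem_union_right _ h)

variable {Θ : Ω → Ω} (g : ι → BlockIdx d N → Ω → ℝ)

/-- For a coherent reflected array (`g a (θc) = g a c ∘ Θ`) the product over the NEGATIVE half of the
observables of an assignment `τ` is the reflection of the product over the positive half of the reflected
assignment: `∏_{c ∈ H₋} g (τ c) c = (∏_{c ∈ H₊} g (τ (θc)) c) ∘ Θ`. [cite: FrohlichIsraelLiebSimon1978, Thm 4.1 (proof)] -/
theorem prod_halfMinus_eq_prod_halfPlus_comp (hN : Even N) {i : Fin d} {k : ZMod N}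
    (hgΘ : ∀ a c ω, g a (cellReflect i k c) ω = g a c (Θ ω)) (τ : BlockIdx d N → ι) (ω : Ω) :
    ∏ c ∈ halfMinus N i k, g (τ c) c ω = ∏ c ∈ halfPlus N i k, g (τ (cellReflect i k c)) c (Θ ω) := by
  rw [halfMinus_eq_map_halfPlus hN i k, Finset.prod_map]
  refine Finset.prod_congr rfl fun c _ => ?_
  rw [Equiv.coe_toEmbedding, hgΘ]

/-- Weight of the positive symmetrisation: `∏_c g ((asgSymP i k τ) c) c = P · (P ∘ Θ)` with
`P = ∏_{c ∈ H₊} g (τ c) c`. [cite: FrohlichIsraelLiebSimon1978, Thm 4.1 (proof)] -/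
theorem prod_asgSymP_eq (hN : Even N) {i : Fin d} {k : ZMod N}
    (hgΘ : ∀ a c ω, g a (cellReflect i k c) ω = g a c (Θ ω)) (τ : BlockIdx d N → ι) (ω : Ω) :
    ∏ c, g (asgSymP i k τ c) c ω
      = (∏ c ∈ halfPlus N i k, g (τ c) c ω) * ∏ c ∈ halfPlus N i k, g (τ c) c (Θ ω) := by
  rw [prod_univ_eq_prod_halfPlus_mul_prod_halfMinus i k]
  congr 1
  · exact Finset.prod_congr rfl fun c hc => by rw [asgSymP_apply_of_mem _ hc]
  · rw [halfMinus_eq_map_halfPlus hN i k, Finset.prod_map]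
    refine Finset.prod_congr rfl fun c hc => ?_
    rw [Equiv.coe_toEmbedding,
      asgSymP_apply_of_not_mem _ (fun h => not_mem_halfMinus_of_mem_halfPlus h (cellReflect_mem_halfMinus hN hc)),
      cellReflect_cellReflect, hgΘ]

/-- Weight of the negative symmetrisation: `∏_c g ((asgSymM i k τ) c) c = Q · (Q ∘ Θ)` with
`Q = ∏_{c ∈ H₊} g (τ (θc)) c`. [cite: FrohlichIsraelLiebSimon1978, Thm 4.1 (proof)] -/
theorem prod_asgSymM_eq (hN : Even N) {i : Fin d} {k : ZMod N}
    (hgΘ : ∀ a c ω, g a (cellReflect i k c) ω = g a c (Θ ω)) (τ : BlockIdx d N → ι) (ω : Ω) :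
    ∏ c, g (asgSymM i k τ c) c ω
      = (∏ c ∈ halfPlus N i k, g (τ (cellReflect i k c)) c ω) *
          ∏ c ∈ halfPlus N i k, g (τ (cellReflect i k c)) c (Θ ω) := by
  rw [prod_univ_eq_prod_halfPlus_mul_prod_halfMinus i k]
  congr 1
  · exact Finset.prod_congr rfl fun c hc => by
      rw [asgSymM_apply_of_not_mem _ (not_mem_halfMinus_of_mem_halfPlus hc)]
  · rw [halfMinus_eq_map_halfPlus hN i k, Finset.prod_map]
    refine Finset.prod_congr rfl fun c hc => ?_
    rw [Equiv.coe_toEmbedding, asgSymM_apply_of_mem _ (cellReflect_mem_halfMinus hN hc), hgΘ]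

/-- Weight of the assignment itself: `∏_c g (τ c) c = P · (Q ∘ Θ)`. [cite: FrohlichIsraelLiebSimon1978, Thm 4.1 (proof)] -/
theorem prod_univ_eq_P_mul_Q_comp (hN : Even N) {i : Fin d} {k : ZMod N}
    (hgΘ : ∀ a c ω, g a (cellReflect i k c) ω = g a c (Θ ω)) (τ : BlockIdx d N → ι) (ω : Ω) :
    ∏ c, g (τ c) c ω
      = (∏ c ∈ halfPlus N i k, g (τ c) c ω) * ∏ c ∈ halfPlus N i k, g (τ (cellReflect i k c)) c (Θ ω) := by
  rw [prod_univ_eq_prod_halfPlus_mul_prod_halfMinus i k, prod_halfMinus_eq_prod_halfPlus_comp g hN hgΘ]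

end Array

/-! ### The chessboard estimate, observable form -/

section Main

variable {d N : ℕ} [NeZero N] {ι : Type*} (μ : Measure Ω) [IsProbabilityMeasure μ]

/-- **The chessboard estimate from reflection positivity, observable form** (Fröhlich–Israel–Lieb–Simon
1978 Thm 4.1, with the reflection structure of an even torus as in Thm 4.3; Friedli–Velenik Thm 10.11;
Biskup Thm 5.8).  `μ` a probability measure; `Θ i k` (`i : Fin d`, `k : ℤ/N`, `N` even, `d ≥ 1`)
`μ`-preserving involutions; `𝓕₊ i k ≤ mΩ` sub-σ-algebras with `μ` reflection positive
(`0 ≤ ∫ F·(F ∘ Θ i k)` for bounded `𝓕₊ i k`-measurable `F`); `g a c` bounded measurable observables forming a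
coherent reflected array (`g a (cellReflect i k c) = g a c ∘ Θ i k`) localised in the positive halves
(`g a c` is `𝓕₊ i k`-measurable for `c ∈ halfPlus N i k`).  Then for every label assignment `σ`:
`|∫ ∏_c g (σ c) c dμ| ^ (N^d) ≤ ∏_c ∫ ∏_{c'} g (σ c) c' dμ` — the absolute expectation of a product of
block observables is bounded by the geometric mean of the expectations of their full reflected arrays.
[cite: FrohlichIsraelLiebSimon1978, Thm 4.1] [cite: FriedliVelenik2017, Thm 10.11] -/
theorem chessboard_integral_prod_of_reflectionPositive (hd : 0 < d) (hN : Even N)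
    (Θ : Fin d → ZMod N → Ω → Ω) (hΘμ : ∀ i k, MeasurePreserving (Θ i k) μ μ)
    (hΘΘ : ∀ i k ω, Θ i k (Θ i k ω) = ω)
    (mP : Fin d → ZMod N → MeasurableSpace Ω) (hmP : ∀ i k, mP i k ≤ mΩ)
    (hRP : ∀ (i : Fin d) (k : ZMod N) (F : Ω → ℝ), Measurable[mP i k] F → (∃ C, ∀ ω, |F ω| ≤ C) →
      0 ≤ ∫ ω, F ω * F (Θ i k ω) ∂μ)
    (g : ι → BlockIdx d N → Ω → ℝ) (hgb : ∀ a c, ∃ C, ∀ ω, |g a c ω| ≤ C)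
    (hgP : ∀ a c (i : Fin d) (k : ZMod N), c ∈ halfPlus N i k → Measurable[mP i k] (g a c))
    (hgΘ : ∀ a (i : Fin d) (k : ZMod N) c ω, g a (cellReflect i k c) ω = g a c (Θ i k ω))
    (σ : BlockIdx d N → ι) :
    |∫ ω, ∏ c, g (σ c) c ω ∂μ| ^ (N ^ d) ≤ ∏ c, ∫ ω, ∏ c', g (σ c) c' ω ∂μ := by
  refine chessboard_abs_pow_le_prod_const hd hN (fun τ => ∫ ω, ∏ c, g (τ c) c ω ∂μ) ?_ σ
  intro i k τ
  -- the two positive-half products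
  set P : Ω → ℝ := fun ω => ∏ c ∈ halfPlus N i k, g (τ c) c ω with hPdef
  set Q : Ω → ℝ := fun ω => ∏ c ∈ halfPlus N i k, g (τ (cellReflect i k c)) c ω with hQdef
  have hPm : Measurable[mP i k] P := Finset.measurable_prod _ fun c hc => hgP _ _ i k hc
  have hQm : Measurable[mP i k] Q := Finset.measurable_prod _ fun c hc => hgP _ _ i k hc
  have hPb : ∃ C, ∀ ω, |P ω| ≤ C := cbObs_exists_abs_prod_le _ fun c _ => hgb _ _
  have hQb : ∃ C, ∀ ω, |Q ω| ≤ C := cbObs_exists_abs_prod_le _ fun c _ => hgb _ _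
  have eP : (fun ω => ∏ c, g (asgSymP i k τ c) c ω) = fun ω => P ω * P (Θ i k ω) :=
    funext fun ω => prod_asgSymP_eq g hN (hgΘ · i k) τ ω
  have eM : (fun ω => ∏ c, g (asgSymM i k τ c) c ω) = fun ω => Q ω * Q (Θ i k ω) :=
    funext fun ω => prod_asgSymM_eq g hN (hgΘ · i k) τ ω
  have e0 : (fun ω => ∏ c, g (τ c) c ω) = fun ω => P ω * Q (Θ i k ω) :=
    funext fun ω => prod_univ_eq_P_mul_Q_comp g hN (hgΘ · i k) τ ω
  rw [eP, eM, e0]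
  exact ⟨hRP i k P hPm hPb, hRP i k Q hQm hQb,
    rp_cauchySchwarz_of_reflectionPositive (hmP i k) (hΘμ i k) (hΘΘ i k) (hRP i k) hPm hQm hPb hQb⟩

omit [IsProbabilityMeasure μ] in
/-- The expectation of a full reflected array is non-negative (it is `⟨F·(F ∘ Θ)⟩` for the boundary `0`
in direction `0`). [cite: FrohlichIsraelLiebSimon1978, Thm 4.1] -/
theorem integral_array_nonneg (hd : 0 < d) (hN : Even N)
    (Θ : Fin d → ZMod N → Ω → Ω)
    (mP : Fin d → ZMod N → MeasurableSpace Ω)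
    (hRP : ∀ (i : Fin d) (k : ZMod N) (F : Ω → ℝ), Measurable[mP i k] F → (∃ C, ∀ ω, |F ω| ≤ C) →
      0 ≤ ∫ ω, F ω * F (Θ i k ω) ∂μ)
    (g : ι → BlockIdx d N → Ω → ℝ) (hgb : ∀ a c, ∃ C, ∀ ω, |g a c ω| ≤ C)
    (hgP : ∀ a c (i : Fin d) (k : ZMod N), c ∈ halfPlus N i k → Measurable[mP i k] (g a c))
    (hgΘ : ∀ a (i : Fin d) (k : ZMod N) c ω, g a (cellReflect i k c) ω = g a c (Θ i k ω)) (a : ι) :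
    0 ≤ ∫ ω, ∏ c, g a c ω ∂μ := by
  set i : Fin d := ⟨0, hd⟩
  have e : (fun ω => ∏ c, g a c ω) = fun ω => (∏ c ∈ halfPlus N i 0, g a c ω) *
      ∏ c ∈ halfPlus N i 0, g a c (Θ i 0 ω) := by
    funext ω
    have h := prod_asgSymP_eq g hN (hgΘ · i (0 : ZMod N)) (fun _ => a) ω
    rwa [asgSymP_const] at h
  rw [e]
  exact hRP i 0 _ (Finset.measurable_prod _ fun c hc => hgP _ _ i 0 hc) (cbObs_exists_abs_prod_le _ fun c _ => hgb _ _)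

/-- **Chessboard estimate, root form**: `|∫ ∏_c g (σ c) c dμ| ≤ ∏_c (∫ ∏_{c'} g (σ c) c' dμ) ^ (1/N^d)` —
FILS (4.3) / Friedli–Velenik (10.20) with the seminorm `γ(f) = ⟨array of f⟩^{1/N^d}`.
[cite: FrohlichIsraelLiebSimon1978, Thm 4.1] [cite: FriedliVelenik2017, Thm 10.11] -/
theorem chessboard_integral_prod_le_prod_rpow (hd : 0 < d) (hN : Even N)
    (Θ : Fin d → ZMod N → Ω → Ω) (hΘμ : ∀ i k, MeasurePreserving (Θ i k) μ μ)
    (hΘΘ : ∀ i k ω, Θ i k (Θ i k ω) = ω)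
    (mP : Fin d → ZMod N → MeasurableSpace Ω) (hmP : ∀ i k, mP i k ≤ mΩ)
    (hRP : ∀ (i : Fin d) (k : ZMod N) (F : Ω → ℝ), Measurable[mP i k] F → (∃ C, ∀ ω, |F ω| ≤ C) →
      0 ≤ ∫ ω, F ω * F (Θ i k ω) ∂μ)
    (g : ι → BlockIdx d N → Ω → ℝ) (hgb : ∀ a c, ∃ C, ∀ ω, |g a c ω| ≤ C)
    (hgP : ∀ a c (i : Fin d) (k : ZMod N), c ∈ halfPlus N i k → Measurable[mP i k] (g a c))
    (hgΘ : ∀ a (i : Fin d) (k : ZMod N) c ω, g a (cellReflect i k c) ω = g a c (Θ i k ω))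
    (σ : BlockIdx d N → ι) :
    |∫ ω, ∏ c, g (σ c) c ω ∂μ| ≤ ∏ c, (∫ ω, ∏ c', g (σ c) c' ω ∂μ) ^ ((1 : ℝ) / (N : ℝ) ^ d) := by
  have hmain := chessboard_integral_prod_of_reflectionPositive μ hd hN Θ hΘμ hΘΘ mP hmP hRP g hgb hgP hgΘ σ
  have hnn : ∀ c, 0 ≤ ∫ ω, ∏ c', g (σ c) c' ω ∂μ := fun c =>
    integral_array_nonneg μ hd hN Θ mP hRP g hgb hgP hgΘ (σ c)
  have hM : (0 : ℝ) < (N : ℝ) ^ d := by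
    have : (0 : ℝ) < N := by exact_mod_cast Nat.pos_of_ne_zero (NeZero.ne N)
    positivity
  have hMnat : ((N ^ d : ℕ) : ℝ) = (N : ℝ) ^ d := by push_cast; ring
  -- take the `N^d`-th root of both sides
  have h1 : |∫ ω, ∏ c, g (σ c) c ω ∂μ| = (|∫ ω, ∏ c, g (σ c) c ω ∂μ| ^ (N ^ d)) ^ ((1 : ℝ) / (N : ℝ) ^ d) := by
    rw [← Real.rpow_natCast, ← Real.rpow_mul (abs_nonneg _), hMnat, mul_one_div_cancel hM.ne', Real.rpow_one]
  rw [h1, Real.finsetProd_rpow _ _ (fun c _ => hnn c)]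
  exact Real.rpow_le_rpow (pow_nonneg (abs_nonneg _) _) hmain (by positivity)

/-- **Chessboard estimate for a product over a subset of blocks** (the other blocks carry the observable
`1`, whose array has expectation `1`): for `S` a set of blocks and labels `lab : S → ι`,
`|∫ ∏_{c ∈ S} g (lab c) c dμ| ≤ ∏_{c ∈ S} (∫ ∏_{c'} g (lab c) c' dμ) ^ (1/N^d)`.  This is the form in which
FILS Thm 4.1 is applied to `n` observables sitting in `n` distinct blocks. [cite: FrohlichIsraelLiebSimon1978, Thm 4.1] -/
theorem chessboard_integral_prod_subset_le (hd : 0 < d) (hN : Even N)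
    (Θ : Fin d → ZMod N → Ω → Ω) (hΘμ : ∀ i k, MeasurePreserving (Θ i k) μ μ)
    (hΘΘ : ∀ i k ω, Θ i k (Θ i k ω) = ω)
    (mP : Fin d → ZMod N → MeasurableSpace Ω) (hmP : ∀ i k, mP i k ≤ mΩ)
    (hRP : ∀ (i : Fin d) (k : ZMod N) (F : Ω → ℝ), Measurable[mP i k] F → (∃ C, ∀ ω, |F ω| ≤ C) →
      0 ≤ ∫ ω, F ω * F (Θ i k ω) ∂μ)
    (g : ι → BlockIdx d N → Ω → ℝ) (hgb : ∀ a c, ∃ C, ∀ ω, |g a c ω| ≤ C)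
    (hgP : ∀ a c (i : Fin d) (k : ZMod N), c ∈ halfPlus N i k → Measurable[mP i k] (g a c))
    (hgΘ : ∀ a (i : Fin d) (k : ZMod N) c ω, g a (cellReflect i k c) ω = g a c (Θ i k ω))
    (S : Finset (BlockIdx d N)) (lab : BlockIdx d N → ι) :
    |∫ ω, ∏ c ∈ S, g (lab c) c ω ∂μ| ≤ ∏ c ∈ S, (∫ ω, ∏ c', g (lab c) c' ω ∂μ) ^ ((1 : ℝ) / (N : ℝ) ^ d) := by
  classical
  -- adjoin the unit observable as the label `none`
  let g' : Option ι → BlockIdx d N → Ω → ℝ := fun o c => o.elim (fun _ => 1) (fun a => g a c)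
  have hg'b : ∀ o c, ∃ C, ∀ ω, |g' o c ω| ≤ C := by
    rintro (_ | a) c
    · exact ⟨1, fun ω => by simp [g']⟩
    · exact hgb a c
  have hg'P : ∀ o c (i : Fin d) (k : ZMod N), c ∈ halfPlus N i k → Measurable[mP i k] (g' o c) := by
    rintro (_ | a) c i k hc
    · exact measurable_const
    · exact hgP a c i k hc
  have hg'Θ : ∀ o (i : Fin d) (k : ZMod N) c ω, g' o (cellReflect i k c) ω = g' o c (Θ i k ω) := by
    rintro (_ | a) i k c ω
    · rfl
    · exact hgΘ a i k c ω
  let σ : BlockIdx d N → Option ι := fun c => if c ∈ S then some (lab c) else none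
  have h := chessboard_integral_prod_le_prod_rpow μ hd hN Θ hΘμ hΘΘ mP hmP hRP g' hg'b hg'P hg'Θ σ
  -- the product over all blocks of the assignment `σ` is the product over `S`
  have hprod : ∀ ω, ∏ c, g' (σ c) c ω = ∏ c ∈ S, g (lab c) c ω := by
    intro ω
    rw [← Finset.prod_subset (Finset.subset_univ S) (fun c _ hc => by simp [σ, g', hc])]
    exact Finset.prod_congr rfl fun c hc => by simp [σ, g', hc]
  have harr : ∏ c, (∫ ω, ∏ c', g' (σ c) c' ω ∂μ) ^ ((1 : ℝ) / (N : ℝ) ^ d)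
      = ∏ c ∈ S, (∫ ω, ∏ c', g (lab c) c' ω ∂μ) ^ ((1 : ℝ) / (N : ℝ) ^ d) := by
    rw [← Finset.prod_subset (Finset.subset_univ S) (fun c _ hc => by simp [σ, g', hc])]
    exact Finset.prod_congr rfl fun c hc => by simp [σ, g', hc]
  simp only [hprod] at h
  rwa [harr] at h

end Main

end Literature.Probability.LatticeModels

end
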